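import Summits.BirchSwinnertonDyer.BirchSwinnertonDyer.Theses.KolyvaginRankRigidityAtTwo
import Summits.BirchSwinnertonDyer.BirchSwinnertonDyer.Theses.GenusKolyvaginAtTwo
import Summits.BirchSwinnertonDyer.BirchSwinnertonDyer.Theorems.ErratumRoadFiveNonSurjCornerKolyJProp44Choice
import Summits.BirchSwinnertonDyer.BirchSwinnertonDyer.Theorems.Rank1ResidualJetCompatibleData
import Summits.BirchSwinnertonDyer.BirchSwinnertonDyer.Theorems.KolyvaginRankRigidityAtTwoAdmissibleAtTwo
import Literature.NumberTheory.EllipticCurves.HeegnerPointsOfConductorRationalityProofs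
import Literature.NumberTheory.EllipticCurves.RingClassGalOverCyclicProofs
import HarnessLib

/-!
# Crux V2♭ `KolyvaginCorankLowerBoundAtTwo` (stmt-BirchSwinnertonDyer-24623), line `kolyvagin_depth_split`:
# stub T1 `stub_localTrivialAtConductor` ⟸ GK2's Q2 `KolyvaginRelationAtTwo` (stmt 24880), BY NAME

T1 (Kolyvagin's transversality at `2`, what makes Kolyvagin's matrix `R_{ij}` vanish below the
diagonal): on V2♭'s habitat and frame, for `n = mℓ ∈ Λ` (square-free product of Zhang–Kolyvagin
primes at `2`), `1 ≤ M ≤ M(n)`, and EVERY class `c_M(m)` of conductor `m = n/ℓ` vanishing (minimality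
of the depth), the class `c_M(n)` is LOCALLY TRIVIAL at the place `λ` of `K` above `ℓ`:
`c_M(n) ∈ ker (H¹(K, E[2^M]) → H¹(K_λ, E[2^M]))` (McCallum 1991, Prop. 4.4 «in particular»:
`ord d_M(mℓ)_λ = ord c_M(mℓ)_λ = ord c_M(m)_λ`; Gross 1991, Prop. 6.2 (2)).

WHAT IS PROVED HERE. `stub_localTrivialAtConductor_of_kolyvaginRelationAtTwo`: the registered
signature of T1, VERBATIM, from the route-`GenusKolyvaginAtTwo` item Q2 `KolyvaginRelationAtTwo`
(stmt-BirchSwinnertonDyer-24880: McCallum's Prop. 4.4 «in particular» at `p = 2` for COMPATIBLE data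
`d` (conductor `m`), `d'` (conductor `mℓ`), both conjuncts, every `j`) taken as a hypothesis — the
conditional form that wires this line to Q2 by name. The proof needs NO downward restriction of the
given datum `d` of conductor `mℓ`: (1) SOME datum `d₀` of conductor `m` exists (Gross 1991 §3 CM
facts, PROVED in the tree: `phi_heegnerPointOfConductor_mem_range_map_ringClassField_holds`,
`exists_generator_ringClassGalOver_holds`, assembled by `nonempty_kolyvaginHeegnerData_of_grossCM`);
(2) a datum `d''` of conductor `mℓ` COMPATIBLE with `d₀` in Q2's four clauses exists (bsd-jet's
`Rank1Residual.JET.exists_compatible_data_of_grossCM`, x11b3's coherent ring class tower); (3) Q2 for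
the pair `(d₀, d'')` at `j = 0` with `c_M(m)(d₀) = 0` gives `c_M(mℓ)(d'') ∈ ker loc_λ`; (4) the classes
of `d''` and `d` differ by a `2`-adic unit (choice independence at one Zhang–Kolyvagin level,
`Prop44.zsmul_kolyvaginClass_mem_iff_of_sameLevel`, with McCallum's admissibility (5) at `2` on the
habitat, `KolyvaginAtTwo.isAdmissible_pointsSubgroup_two_of_heegner`, p607145), so
`c_M(mℓ)(d) ∈ ker loc_λ`. The margin `M + 1 ≤ M(n)` of the registered signature is not used (only
`M ≤ M(ℓ')` for `ℓ' ∣ n`, the level clause of Q2).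

HONEST FRAMING. CONDITIONAL on Q2 `KolyvaginRelationAtTwo` (24880, open; its missing tree input is
Gross 1991 Prop. 3.7 (2) at conductor `n > 1`, the named fact `GrossLMS1991.prop37_2_frobeniusCongruence`,
plus the `p = 2` re-run of the concrete Prop. 4.4 dictionary with GK2's any-`p` END
`GenusExact.zsmul_kolyvaginClass_localOrders_of_heegnerInputs`). The registered stub
`stub_localTrivialAtConductor` is NOT closed by this file; V2♭ is not proved; BSD is not proved by
any of this.

References: [McCallumLMS1991] §4 Lemma 4.3, Prop. 4.4 with «In particular» (p. 301; held
`book:editornd-l-functions-arithmetic` chunk p0282), (4)–(5) (p. 300); [GrossLMS1991] §3 (pp. 238–239),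
§4 (4.1), Prop. 6.2 (2); [WZhang2014] Notations (xii); [Kolyvagin1991MathAnn] §2 Thm. 2.2.
-/

set_option autoImplicit false
-- the Theorems namespace of this sub repeats the summit name by design (D-0017 nested layout)
set_option linter.dupNamespace false

noncomputable section

open scoped Classical

open WeierstrassCurve Literature.NumberTheory.EllipticCurves
  Literature.NumberTheory.EllipticCurves.ModularForms NumberField IsDedekindDomain
open Summit.BirchSwinnertonDyer.BirchSwinnertonDyer.Theses.KolyvaginRankRigidityAtTwo
open Summit.BirchSwinnertonDyer.BirchSwinnertonDyer.Theses.GenusKolyvaginAtTwo (KolyvaginRelationAtTwo)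

namespace Summit.BirchSwinnertonDyer.BirchSwinnertonDyer.Theorems.KolyvaginLowerBoundAtTwo

-- `K : Type`: the tree's ring-class class field theory is universe `0`.
variable {K : Type} [Field K] [NumberField K]

/-- **T1 in the `(m, ℓ)` currency of Q2, from Q2.** For `W/ℚ` globally minimal elliptic, non-CM,
with surjective `2`-adic tower, `K` imaginary quadratic with `d_K` odd, `d_K ∉ {−3, −4}` and the
Heegner hypothesis for `N_E`, a frame `(Dt, β, ι)`, `mℓ` square-free (`ℓ` prime, `ℓ ∤ m`) with
Zhang–Kolyvagin prime factors at `2` of index `≥ M ≥ 1`, ANY datum `d` of conductor `mℓ`, and every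
class of conductor `m` vanishing (`∀ d₀, c_M(m)(d₀) = 0`): `c_M(mℓ)(d)` is locally trivial at the place
`λ ∋ ℓ` — granted Q2 `KolyvaginRelationAtTwo`. Steps: a datum `d₀` at `m` (Gross §3 CM facts, proved),
a datum `d''` at `mℓ` compatible with `d₀` (coherent ring class tower), Q2 at `j = 0`, choice
independence `d'' ↔ d` at level `mℓ`. [cite: McCallumLMS1991, §4 Prop. 4.4 «In particular» (p. 301), (4)–(5)]
[cite: GrossLMS1991, §3 (pp. 238–239), §4 (4.1), Prop. 6.2 (2)] [cite: WZhang2014, Notations (xii)] -/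
theorem kolyvaginClass_mem_torsionLocalKer_of_kolyvaginRelationAtTwo
    (h24880 : KolyvaginRelationAtTwo) (W : WeierstrassCurve ℚ) [W.IsElliptic] [W.IsGloballyMinimal]
    [NeZero (W.conductorNorm ℤ)] (hCM : ¬ W.HasCM)
    (hsur : ∀ m : ℕ, W.HasSurjectiveModNGaloisRep (2 ^ m : ℕ))
    (hK : IsImaginaryQuadratic K) (hne3 : NumberField.discr K ≠ -3)
    (hne4 : NumberField.discr K ≠ -4) (h2d : ¬ ((2 : ℤ) ∣ NumberField.discr K))
    (hHN : SatisfiesHeegnerHypothesis (W.conductorNorm ℤ) K)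
    (Dt : ModularParametrizationData W (W.conductorNorm ℤ)) (β : ℤ) (ι : K →+* ℂ)
    {m ℓ M : ℕ} (hsq : Squarefree (m * ℓ)) (hℓ : ℓ.Prime) (hℓm : ¬ ℓ ∣ m) (hM : 1 ≤ M)
    (hS : ∀ q ∈ (m * ℓ).primeFactors, Zhang2014.IsKolyvaginPrime (W.conductorNorm ℤ) W K 2 q ∧
      M ≤ Zhang2014.kolyvaginIndex W 2 q)
    (d : KolyvaginHeegnerData Dt β ι (m * ℓ))
    (hvan : ∀ d₀ : KolyvaginHeegnerData Dt β ι m, d₀.kolyvaginClass Nat.prime_two M = 0)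
    (v : HeightOneSpectrum (𝓞 K)) (hv : ((ℓ : ℕ) : 𝓞 K) ∈ v.asIdeal) :
    d.kolyvaginClass Nat.prime_two M ∈
      (W.baseChange K).torsionLocalKer (v.adicCompletion K) ((2 ^ M : ℕ) : ℤ) := by
  have hn0 : m * ℓ ≠ 0 := hsq.ne_zero
  have hmsq : Squarefree m := hsq.squarefree_of_dvd (dvd_mul_right m ℓ)
  have hD : NumberField.discr K < -4 :=
    Summit.BirchSwinnertonDyer.Rank1Residual.X11b.KolyvaginAssembly.discr_lt_neg_four hK ⟨hne3, hne4⟩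
  have hodd : Odd (NumberField.discr K) :=
    Int.not_even_iff_odd.mp fun h ↦ h2d (even_iff_two_dvd.mp h)
  have hs2 : W.HasSurjectiveModNGaloisRep 2 := by simpa using hsur 1
  have hSm : ∀ q ∈ m.primeFactors, Zhang2014.IsKolyvaginPrime (W.conductorNorm ℤ) W K 2 q :=
    fun q hq ↦ (hS q (Nat.primeFactors_mono (dvd_mul_right m ℓ) hn0 hq)).1
  have hℓn : ℓ ∈ (m * ℓ).primeFactors := Nat.mem_primeFactors.mpr ⟨hℓ, dvd_mul_left ℓ m, hn0⟩
  have hKol : Zhang2014.IsKolyvaginPrime (W.conductorNorm ℤ) W K 2 ℓ := (hS ℓ hℓn).1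
  have hℓc : ℓ ∉ m.primeFactors := fun h ↦ hℓm (Nat.dvd_of_mem_primeFactors h)
  have hinert : ∀ q ∈ m.primeFactors, (Ideal.span {(q : 𝓞 K)}).IsPrime :=
    fun q hq ↦ (hSm q hq).2.2.2.2.1
  -- (1) SOME datum of conductor `m` (Gross 1991 §3: the two CM facts, proved in the tree)
  obtain ⟨d₀⟩ := nonempty_kolyvaginHeegnerData_of_grossCM
    (phi_heegnerPointOfConductor_mem_range_map_ringClassField_holds (W.conductorNorm ℤ) W K)
    exists_generator_ringClassGalOver_holds hK hHN Dt β ι d.dvd_sq_sub hmsq hinert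
  -- (2) a datum of conductor `mℓ` COMPATIBLE with `d₀` (Gross's one system of choices, read upward)
  obtain ⟨dℓ, hdℓ⟩ := Summit.BirchSwinnertonDyer.Rank1Residual.JET.exists_compatible_data_of_grossCM
    (phi_heegnerPointOfConductor_mem_range_map_ringClassField_holds (W.conductorNorm ℤ) W K) hK hD hHN
    2 Dt β ι hmsq hSm d₀
  obtain ⟨hσ, hS₁, hS₂, hemb⟩ := hdℓ ℓ hKol hℓc
  -- (3) Q2 for the compatible pair `(d₀, d'')`, second conjunct, `j = 0`, with `c_M(m)(d₀) = 0`
  have hQ2 := (h24880 W hCM K hK hne3 hne4 hHN hsur Dt β ι M hM m ℓ hsq hℓ hℓm hS d₀ (dℓ ℓ hKol hℓc)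
    hσ hS₁ hS₂ hemb v hv 0).2
  have h0 : ((2 ^ 0 : ℕ) : ℤ) • d₀.kolyvaginClass Nat.prime_two M ∈
      (W.baseChange K).torsionLocalKer (v.adicCompletion K) ((2 ^ M : ℕ) : ℤ) := by
    rw [hvan d₀, zsmul_zero]
    exact zero_mem _
  have h'' := hQ2.mpr h0
  -- (4) choice independence at the Zhang–Kolyvagin level `mℓ` (admissibility (5) at `2`, habitat)
  have hA'' : KolyvaginCocycle.IsAdmissible (Field.absoluteGaloisGroup K) (dℓ ℓ hKol hℓc).pointsSubgroup
      ((2 ^ M : ℕ) : ℤ) :=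
    KolyvaginAtTwo.isAdmissible_pointsSubgroup_two_of_heegner (dℓ ℓ hKol hℓc) hs2 hK hodd hHN hn0 M
  have hsw := (Prop44.zsmul_kolyvaginClass_mem_iff_of_sameLevel hK ι hD hHN Dt Nat.prime_two hM hsq
    hS (dℓ ℓ hKol hℓc) d hA''
    ((W.baseChange K).torsionLocalKer (v.adicCompletion K) ((2 ^ M : ℕ) : ℤ)) ((2 ^ 0 : ℕ) : ℤ)).mpr h''
  rw [show ((2 ^ 0 : ℕ) : ℤ) = 1 by norm_num, one_zsmul] at hsw
  exact hsw

/-- **T1 `stub_localTrivialAtConductor` (registered signature, VERBATIM) from Q2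
`KolyvaginRelationAtTwo` (stmt-BirchSwinnertonDyer-24880).** On V2♭'s habitat and frame: if `n ∈ Λ`
(square-free product of Kolyvagin primes at `2`), `1 ≤ M`, `M + 1 ≤ M(n)`, `ℓ ∣ n`, and EVERY class
`c_M(n/ℓ)` of conductor `n/ℓ` vanishes (minimality of the depth), then `c_M(n)` is locally trivial at
the place `λ` of `K` above `ℓ`: `c_M(n) ∈ ker (H¹(K, E[2^M]) → H¹(K_λ, E[2^M]))` — McCallum 1991
Prop. 4.4 «in particular» `ord c_M(mℓ)_λ = ord c_M(m)_λ` read at `p = 2` through Q2, transported along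
`n = (n/ℓ)·ℓ`. Conditional wiring of line `kolyvagin_depth_split` to GK2's Q2 by name; the stub
itself stays open. [cite: McCallumLMS1991, §4 Prop. 4.4 «In particular» (p. 301), Cor. 4.5]
[cite: GrossLMS1991, §3 Prop. 3.7, §6 Prop. 6.2 (2)] [cite: Kolyvagin1991MathAnn, §2 Thm. 2.2] -/
theorem stub_localTrivialAtConductor_of_kolyvaginRelationAtTwo (h24880 : KolyvaginRelationAtTwo) :
    ∀ (W : WeierstrassCurve ℚ) [W.IsElliptic] [W.IsGloballyMinimal], ¬ W.HasCM →
      (Rank1Residual.GoodOrd W 2 ∨ Rank1Residual.Mult W 2) →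
      (∀ m : ℕ, W.HasSurjectiveModNGaloisRep (2 ^ m : ℕ)) →
      ∀ (K : Type) [Field K] [NumberField K], IsImaginaryQuadratic K → NumberField.discr K ≠ -3 →
      NumberField.discr K ≠ -4 → ¬ ((2 : ℤ) ∣ NumberField.discr K) → ∀ [NeZero (W.conductorNorm ℤ)],
      SatisfiesHeegnerHypothesis (W.conductorNorm ℤ) K →
      ∀ (Dt : ModularParametrizationData W (W.conductorNorm ℤ)) (β : ℤ) (ι : K →+* ℂ)
        (n : ℕ) (d : KolyvaginHeegnerData Dt β ι n) (M ℓ : ℕ),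
        KolyvaginDescent.KolSupp (Zhang2014.IsKolyvaginPrime (W.conductorNorm ℤ) W K 2) n →
        1 ≤ M → ((M + 1 : ℕ) : ℕ∞) ≤ Zhang2014.levelIndex W 2 n → ℓ ∈ n.primeFactors →
        (∀ d₀ : KolyvaginHeegnerData Dt β ι (n / ℓ), d₀.kolyvaginClass Nat.prime_two M = 0) →
        ∀ v : HeightOneSpectrum (𝓞 K), ((ℓ : ℕ) : 𝓞 K) ∈ v.asIdeal →
          d.kolyvaginClass Nat.prime_two M ∈
            (W.baseChange K).torsionLocalKer (v.adicCompletion K) ((2 ^ M : ℕ) : ℤ) := by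
  intro W _ _ hCM _hred hsur K _ _ hK hne3 hne4 h2d _ hHN Dt β ι n d M ℓ hn hM1 hMle hℓ hvan v hv
  obtain ⟨hℓp, hℓn, -⟩ := Nat.mem_primeFactors.mp hℓ
  obtain ⟨m, rfl⟩ : ∃ m, n = m * ℓ := ⟨n / ℓ, (Nat.div_mul_cancel hℓn).symm⟩
  rw [Nat.mul_div_cancel m hℓp.pos] at hvan
  have hsq : Squarefree (m * ℓ) := hn.1
  have hℓm : ¬ ℓ ∣ m := fun h ↦
    hℓp.one_lt.ne' (Nat.isUnit_iff.mp (hsq ℓ (mul_dvd_mul_right h ℓ)))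
  have hS : ∀ q ∈ (m * ℓ).primeFactors, Zhang2014.IsKolyvaginPrime (W.conductorNorm ℤ) W K 2 q ∧
      M ≤ Zhang2014.kolyvaginIndex W 2 q := fun q hq ↦
    ⟨hn.2 q hq, (Nat.le_succ M).trans ((Zhang2014.natCast_le_levelIndex_iff.mp hMle) q hq)⟩
  exact kolyvaginClass_mem_torsionLocalKer_of_kolyvaginRelationAtTwo h24880 W hCM hsur hK hne3 hne4
    h2d hHN Dt β ι hsq hℓp hℓm hM1 hS d hvan v hv

end Summit.BirchSwinnertonDyer.BirchSwinnertonDyer.Theorems.KolyvaginLowerBoundAtTwo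

end
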